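import Literature.Probability.RandomPlanarGeometry.NestingTransform
import Literature.Probability.Percolation.FullPlaneCNLProofs
import Literature.Probability.Percolation.CLE6RerootSaturated
import Literature.Probability.Percolation.SiteInterfaceStructure
import Literature.Probability.Percolation.SiteInterfaceWinding
import Literature.Probability.Percolation.TriAnnulusArms
import Literature.Probability.Percolation.InterfaceScalingLimitTriProofs
import HarnessLib

/-!
# Site percolation on `δ𝕋`: finitely many interface loops meet a ball; the nesting weight is bounded

Companion of `FKLoopNestingIntegrable` (bond `ℤ²`) for the typed full-plane loop configuration
`siteLoopConfig δ ω` of site percolation on the triangular lattice (`FullPlaneCNL`), the random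
configuration of the consumer statements `MagicFormulaT` / `TransferContinuity` /
`LoopLimitZ2EqT` of route `CardyMagicRigidity`. At every positive mesh `δ`:

* `unbasedLoop_siteLoopCurve_rotateAt` — rotating a closed honeycomb walk (changing its base
  face, `SimpleGraph.Walk.rotateAt`) does not change its unbased loop (the closed polygon through
  the rotated vertex list is a shift of the uniform parametrisation, `closedPolygon_rotate`);
  hence every loop of `siteLoopConfig δ ω` can be rebased at any face it visits, as an interface
  loop (`IsSiteInterfaceLoop.exists_rebase`);
* `exists_face_of_range_inter_closedBall_nonempty` — a loop of `siteLoopConfig δ ω` whose trace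
  meets `B̄(0, R)` visits a face whose rescaled centre has norm `≤ R + 2δ`;
* `finite_setOf_norm_hexCenter_le` — there are finitely many such faces;
* `ncard_loops_siteLoopConfig_meeting_le` — **the number of loops of `siteLoopConfig δ ω` meeting
  `B̄(0, R)` is bounded, uniformly in `ω`, by the number `N(δ, R)` of those faces** (two interface
  loops of `ω` based at the same face coincide, `IsSiteInterfaceLoop.eq_of_base_eq`);
* `abs_nestingWeight_siteLoopConfig_le`, `abs_truncNestingWeight_siteLoopConfig_le` — hence, for
  a density `f` vanishing off `B̄(0, R)` with `∫ f = 0`, `|A_f(siteLoopConfig δ ω)| ≤ 2^{N(δ,R)}`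
  and the same for the truncated functional: the integrands of `MagicFormulaT` are uniformly
  bounded at fixed mesh (only loops meeting the ball contribute, each by a factor of modulus
  `≤ 2`).

## References

* F. Camia, C. M. Newman, Comm. Math. Phys. 268 (2006), §2, §4 (interface loops as polygons;
  loops through a face).
* H. Duminil-Copin, K. K. Kozlowski, P. Lammers, I. Manolescu, arXiv:2603.06268 (2026), §3.2,
  (5.4) (the loop functional).
-/

noncomputable section

open MeasureTheory Set Filter Metric Function
open scoped Real Topology

namespace Literature.Probability.Percolation

open LatticeModels RandomPlanarGeometry

variable {ω : SiteConfig (Site 2)}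

/-! ### Rebasing a closed honeycomb walk does not change its unbased loop -/

/-- **Rotating a closed honeycomb walk leaves its unbased loop unchanged**: for `1 ≤ k ≤ n`, the
polygon of `w.rotateAt k` is the polygon of `w` started at its `k`-th vertex, a shift of the
uniform parametrisation (`loopPts_rotateAt`, `closedPolygon_rotate`), at unbased distance `0`.
The site analogue of `unbasedLoop_loopCurve_rotate`. [cite: CamiaNewman2006, §2] -/
theorem unbasedLoop_siteLoopCurve_rotateAt (δ : ℝ) {f₀ : HexVertex} (w : hexGraph.Walk f₀ f₀)
    {k : ℕ} (hk0 : 0 < k) (hk : k ≤ w.length) :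
    UnbasedLoop.mk (BasedLoop.mk (siteLoopCurve δ (w.rotateAt k)) (isLoop_siteLoopCurve δ _)) =
      UnbasedLoop.mk (BasedLoop.mk (siteLoopCurve δ w) (isLoop_siteLoopCurve δ w)) := by
  have hlen : 0 < w.length := hk0.trans_le hk
  have hlen' : 0 < (w.rotateAt k).length := by rwa [SimpleGraph.Walk.length_rotateAt w hk]
  rw [UnbasedLoop.mk_eq_mk, BasedLoop.dist_def, BasedLoop.toCurveClass_mk, BasedLoop.toCurveClass_mk,
    siteLoopCurve_eq_closedPolygon δ _ hlen', siteLoopCurve_eq_closedPolygon δ w hlen,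
    loopPts_rotateAt δ w hk0 hk]
  set pts : List ℂ := loopPts δ w with hpts
  have hne : pts ≠ [] := by
    rw [← List.length_pos_iff, hpts, length_loopPts]
    exact hlen
  have hk' : k % pts.length < pts.length := Nat.mod_lt _ (List.length_pos_iff.2 hne)
  rw [← List.rotate_mod, closedPolygon_rotate hne hk', closedPolygon_eq_mk_closedCurve pts,
    CurveClass.loopDist_mk, Curve.loopDist_shift_left (isLoop_closedCurve _) (isLoop_closedCurve _),
    Curve.loopDist_self]

/-- **An interface loop can be rebased at any face it visits**: if `F ∈ support γ` then some
interface loop of `ω` based at `F` has the same unbased loop as `γ` at every mesh.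
[cite: CamiaNewman2006, §2] -/
theorem IsSiteInterfaceLoop.exists_rebase {f₀ : HexVertex} {γ : hexGraph.Walk f₀ f₀}
    (hγ : IsSiteInterfaceLoop ω γ) {F : HexVertex} (hF : F ∈ γ.support) (δ : ℝ) :
    ∃ w : hexGraph.Walk F F, IsSiteInterfaceLoop ω w ∧
      UnbasedLoop.mk (BasedLoop.mk (siteLoopCurve δ w) (isLoop_siteLoopCurve δ w)) =
        UnbasedLoop.mk (BasedLoop.mk (siteLoopCurve δ γ) (isLoop_siteLoopCurve δ γ)) := by
  obtain ⟨i, rfl, hi⟩ := SimpleGraph.Walk.mem_support_iff_exists_getVert.1 hF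
  rcases Nat.eq_zero_or_pos i with rfl | hi0
  · rw [SimpleGraph.Walk.getVert_zero]
    exact ⟨γ, hγ, rfl⟩
  · exact ⟨γ.rotateAt i, hγ.rotateAt hi0 hi, unbasedLoop_siteLoopCurve_rotateAt δ γ hi0 hi⟩

/-! ### Loops meeting a ball visit a face near the ball -/

/-- **A loop of `siteLoopConfig δ ω` meeting `B̄(0, R)` is an interface loop based at a face whose
rescaled centre has norm `≤ R + 2δ`** (`δ > 0`): a point of the trace in the ball lies on a dart
segment, both of whose endpoints are within `δ` of a mesh point (`hexCenter_triEdgeFaces_mem_closedBall`),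
hence within `2δ` of the point; rebase at the tail face of that dart (`exists_rebase`).
[cite: CamiaNewman2006, §4] -/
theorem exists_face_of_range_inter_closedBall_nonempty {δ : ℝ} (hδ : 0 < δ) {R : ℝ}
    {u : UnbasedLoop ℂ} (hu : u ∈ (siteLoopConfig δ ω).loops)
    (hR : (u.range ∩ closedBall (0 : ℂ) R).Nonempty) :
    ∃ (F : HexVertex) (w : hexGraph.Walk F F), IsSiteInterfaceLoop ω w ∧
      UnbasedLoop.mk (BasedLoop.mk (siteLoopCurve δ w) (isLoop_siteLoopCurve δ w)) = u ∧
        ‖(δ : ℂ) * hexCenter F‖ ≤ R + 2 * δ := by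
  rcases hu with ⟨v, γ, hγ, -, rfl⟩ | ⟨v, γ, hγ, -, rfl⟩ <;>
  · obtain ⟨z, hz, hzR⟩ := hR
    have hlen : 0 < γ.length := by have := hγ.isCycle.three_le_length; omega
    rw [range_mk_siteLoopCurve, range_toCurve_eq_polyTrace hlen, mem_polyTrace_iff_exists_dart] at hz
    obtain ⟨d, hd, hzd⟩ := hz
    obtain ⟨e, he, -, -⟩ := hγ.2 d hd
    -- both endpoints of the dart segment are within `δ` of the mesh point `δ e.fst`
    obtain ⟨h1, h2⟩ := hexCenter_triEdgeFaces_mem_closedBall hδ.le e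
    rw [he] at h1 h2
    have hzc : z ∈ closedBall (triMeshPoint δ e.fst) δ :=
      (convex_closedBall _ _).segment_subset h2 h1 hzd
    have hdist : dist z ((δ : ℂ) * hexCenter d.fst) ≤ 2 * δ :=
      calc dist z ((δ : ℂ) * hexCenter d.fst)
          ≤ dist z (triMeshPoint δ e.fst) + dist ((δ : ℂ) * hexCenter d.fst) (triMeshPoint δ e.fst) :=
            dist_triangle_right _ _ _
        _ ≤ δ + δ := add_le_add (mem_closedBall.1 hzc) (mem_closedBall.1 h2)
        _ = 2 * δ := by ring
    have hnorm : ‖(δ : ℂ) * hexCenter d.fst‖ ≤ R + 2 * δ := by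
      have hz0 : ‖z‖ ≤ R := by simpa [mem_closedBall, dist_zero_right] using hzR
      calc ‖(δ : ℂ) * hexCenter d.fst‖ = ‖z - (z - (δ : ℂ) * hexCenter d.fst)‖ := by rw [sub_sub_cancel]
        _ ≤ ‖z‖ + ‖z - (δ : ℂ) * hexCenter d.fst‖ := norm_sub_le _ _
        _ ≤ R + 2 * δ := add_le_add hz0 (by rwa [← dist_eq_norm])
    obtain ⟨w, hw, hwu⟩ := hγ.exists_rebase (γ.dart_fst_mem_support_of_mem_darts hd) δ
    exact ⟨d.fst, w, hw, hwu, hnorm⟩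

/-- **Finitely many faces have rescaled centre of norm `≤ ρ`** (`δ > 0`): their cells are lattice
points at mesh distance `≤ ρ + 2δ` from the origin (`norm_hexCenter_sub_triEmbed_le` of `InterfaceScalingLimitTriProofs`,
`finite_setOf_dist_triMeshPoint_le`). [folklore] -/
theorem finite_setOf_norm_hexCenter_le {δ : ℝ} (hδ : 0 < δ) (ρ : ℝ) :
    {F : HexVertex | ‖(δ : ℂ) * hexCenter F‖ ≤ ρ}.Finite := by
  have hfin := (finite_setOf_dist_triMeshPoint_le hδ 0 (ρ + 2 * δ)).prod (Set.finite_univ (α := Fin 2))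
  refine hfin.subset fun F hF ↦ ⟨?_, Set.mem_univ _⟩
  simp only [mem_setOf_eq] at hF ⊢
  rw [dist_zero_right, triMeshPoint]
  have hδ' : ‖(δ : ℂ)‖ = δ := by rw [Complex.norm_real, Real.norm_eq_abs, abs_of_pos hδ]
  calc ‖(δ : ℂ) * triEmbed F.1‖ = ‖(δ : ℂ) * hexCenter F - (δ : ℂ) * (hexCenter F - triEmbed F.1)‖ := by
        congr 1; ring
    _ ≤ ‖(δ : ℂ) * hexCenter F‖ + ‖(δ : ℂ) * (hexCenter F - triEmbed F.1)‖ := norm_sub_le _ _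
    _ ≤ ρ + δ * 2 := by
        refine add_le_add hF ?_
        rw [norm_mul, hδ']
        exact mul_le_mul_of_nonneg_left (norm_hexCenter_sub_triEmbed_le F) hδ.le
    _ = ρ + 2 * δ := by ring

/-! ### The number of loops meeting a ball is bounded uniformly in the configuration -/

/-- **The loops of `siteLoopConfig δ ω` meeting `B̄(0, R)` form a finite set of cardinality at most
the number `N(δ, R)` of faces with rescaled centre of norm `≤ R + 2δ`**, uniformly in `ω`: each
such loop is THE interface loop of `ω` based at such a face (`exists_face_of_range_inter_closedBall_nonempty`;
two interface loops based at one face coincide, `IsSiteInterfaceLoop.eq_of_base_eq`).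
[cite: CamiaNewman2006, §4] -/
theorem ncard_loops_siteLoopConfig_meeting_le {δ : ℝ} (hδ : 0 < δ) (R : ℝ) (ω : SiteConfig (Site 2)) :
    {u ∈ (siteLoopConfig δ ω).loops | (u.range ∩ closedBall (0 : ℂ) R).Nonempty}.Finite ∧
      {u ∈ (siteLoopConfig δ ω).loops | (u.range ∩ closedBall (0 : ℂ) R).Nonempty}.ncard ≤
        (finite_setOf_norm_hexCenter_le hδ (R + 2 * δ)).toFinset.card := by
  classical
  set Φ : Set HexVertex := {F : HexVertex | ‖(δ : ℂ) * hexCenter F‖ ≤ R + 2 * δ} with hΦ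
  have hΦfin : Φ.Finite := finite_setOf_norm_hexCenter_le hδ (R + 2 * δ)
  -- THE loop of `ω` through a face (junk: the trivial walk) 
  let g : HexVertex → UnbasedLoop ℂ := fun F ↦
    if h : ∃ w : hexGraph.Walk F F, IsSiteInterfaceLoop ω w then
      UnbasedLoop.mk (BasedLoop.mk (siteLoopCurve δ h.choose) (isLoop_siteLoopCurve δ _))
    else UnbasedLoop.mk (BasedLoop.mk (siteLoopCurve δ (SimpleGraph.Walk.nil : hexGraph.Walk F F))
      (isLoop_siteLoopCurve δ _))
  have hsub : {u ∈ (siteLoopConfig δ ω).loops | (u.range ∩ closedBall (0 : ℂ) R).Nonempty} ⊆ g '' Φ := by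
    rintro u ⟨hu, hR⟩
    obtain ⟨F, w, hw, hwu, hF⟩ := exists_face_of_range_inter_closedBall_nonempty hδ hu hR
    refine ⟨F, hF, ?_⟩
    have h : ∃ w : hexGraph.Walk F F, IsSiteInterfaceLoop ω w := ⟨w, hw⟩
    have hg : g F = UnbasedLoop.mk (BasedLoop.mk (siteLoopCurve δ h.choose) (isLoop_siteLoopCurve δ _)) :=
      dif_pos h
    rw [hg, h.choose_spec.eq_of_base_eq hw, hwu]
  have hfin : {u ∈ (siteLoopConfig δ ω).loops | (u.range ∩ closedBall (0 : ℂ) R).Nonempty}.Finite :=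
    (hΦfin.image g).subset hsub
  refine ⟨hfin, ?_⟩
  calc {u ∈ (siteLoopConfig δ ω).loops | (u.range ∩ closedBall (0 : ℂ) R).Nonempty}.ncard
      ≤ (g '' Φ).ncard := Set.ncard_le_ncard hsub (hΦfin.image g)
    _ ≤ Φ.ncard := Set.ncard_image_le hΦfin
    _ = hΦfin.toFinset.card := Set.ncard_eq_toFinset_card Φ hΦfin

end Literature.Probability.Percolation

end
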